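import Literature.NumberTheory.NumberFields.CoinvariantGenusBound
import HarnessLib

/-!
# The `2`-rank of the class group in a quadratic extension with ODD base class number:
# `[Cl(L) : Cl(L)²] · 2 · [E_K : E_K ∩ N_{L/K} Lˣ] ≤ ∏_𝔭 e_𝔭 · ∏_{v∣∞} e_v` (so `rank₂ Cl(L) ≤ t − 1 + log₂ e_∞ − r_E`)

Topic `NumberTheory/NumberFields`; namespace `Literature.NumberTheory.NumberFields.AmbiguousClass`.  THEOREM-ONLY file (no definition, no named fact, no
instance, no `sorry`), written by the prover seat `bsd-2adic-k4-w2` GEN 14 (cell `bsd-2adic`; `--supports` stmt-BirchSwinnertonDyer-22617; closes nothing).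
The `p = 2`, odd-`h_K` reading of the genus bound for the coinvariant quotient (`index_pow_sup_range_mul_le_genus`, `CoinvariantGenusBound.lean`): when `h_K` is
odd, `σc · c = i(N c)` has odd order, so `σc·c⁻¹ = (σc·c)·c⁻²` is a square and the coinvariant subgroup `Cl(L)² · I_σ Cl(L)` is just `Cl(L)²`; and `[Cl(K) : Cl(K)²] = 1`.

* `range_div_id_le_range_pow_two_of_odd` — `L/K` Galois quadratic, `h_K` odd: `I_σ Cl(L) ≤ Cl(L)²`.
* ★ `index_pow_two_mul_le_genus_of_odd_classNumber` — `L/K` Galois of degree `2`, `h_K` odd, `N_{L/K}` onto: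
  **`[Cl(L) : Cl(L)²] · 2 · [E_K : E_K ∩ N Lˣ] ≤ ∏_𝔭 e_𝔭 · e_∞`**; unramified at infinity: `index_pow_two_mul_le_pow_of_odd_classNumber` — `… ≤ 2^t`
  (`t` ramified primes).  The case `[E_K : E_K ∩ N Lˣ] = 2^{t−1}` is the classical «`h_L` odd» criterion (tree `QuadraticExtensionOddClassNumberNonNormUnit.lean`);
  this is its rank form (Gras IV.4: `rank₂ Cl(L) = t − 1 − r_E` exactly when `h_K` is odd — only `≤` is proved here).

References: [Gras2003] G. Gras, *Class Field Theory*, IV.4 (genus theory for cyclic extensions; the odd-`h_K` case); [Lang1990] Ch. 13 §4 Lemma 4.1 (Chevalley);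
[NeukirchANT1999] Ch. III §1 Prop. (1.6) (iv).
-/

set_option autoImplicit false

noncomputable section

open scoped NumberField

namespace Literature.NumberTheory.NumberFields.AmbiguousClass

open _root_.NumberField _root_.IsDedekindDomain
open Literature.NumberTheory.GaloisRepresentations Literature.NumberTheory.GaloisRepresentations.Herbrand
  Literature.NumberTheory.GaloisRepresentations.MinkowskiUnit
  Literature.NumberTheory.GaloisRepresentations.CyclicNormIndex

variable {K L : Type} [Field K] [NumberField K] [Field L] [NumberField L] [Algebra K L]

/-- An element of odd order in a group is a square. [folklore] -/
private theorem exists_sq_eq_of_odd_orderOf {G : Type*} [Group G] {g : G} (h : Odd (orderOf g)) : ∃ y : G, y ^ 2 = g := by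
  obtain ⟨m, hm⟩ := h
  refine ⟨g ^ (m + 1), ?_⟩
  rw [← pow_mul]
  have : (m + 1) * 2 = orderOf g + 1 := by rw [hm]; ring
  rw [this, pow_succ, pow_orderOf_eq_one, one_mul]

/-- **`I_σ Cl(L) ≤ Cl(L)²` for `L/K` Galois quadratic with `h_K` odd**: for a class `c` of `L` and `Gal(L/K) = {1, σ}`,
`c · σc = i_{L/K}(N_{L/K} c)` (Neukirch III (1.6)(iv)) has order dividing `h_K`, hence odd, hence is a square; so `σc · c⁻¹ = (c·σc) · (c⁻¹)²` is a square.
[cite: NeukirchANT1999, Ch. III §1 Prop. (1.6) (iv)] [cite: Gras2003, IV.4] -/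
theorem range_div_id_le_range_pow_two_of_odd [IsGalois K L] (hdeg : Module.finrank K L = 2) (hodd : Odd (classNumber K))
    (σ : L ≃ₐ[K] L) :
    ((ClassGroup.mulEquiv (intAut σ)).toMonoidHom / MonoidHom.id (ClassGroup (𝓞 L))).range ≤
      (powMonoidHom 2 : ClassGroup (𝓞 L) →* ClassGroup (𝓞 L)).range := by
  classical
  haveI : FiniteDimensional K L := Module.Finite.of_restrictScalars_finite ℚ K L
  rintro x ⟨c, rfl⟩
  rw [MonoidHom.div_apply, MonoidHom.id_apply, MulEquiv.coe_toMonoidHom]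
  -- the product over the Galois group is a square (odd order)
  set P : ClassGroup (𝓞 L) := ∏ τ : L ≃ₐ[K] L, ClassGroup.mulEquiv (intAut τ) c with hP
  have hPeq : P = classGroupExtend K L (classGroupNorm K L c) := (classGroupExtend_classGroupNorm_eq_prod K L c).symm
  have hPodd : Odd (orderOf P) := by
    have h1 : orderOf P ∣ orderOf (classGroupNorm K L c) := by rw [hPeq]; exact orderOf_map_dvd _ _
    have h2 : orderOf (classGroupNorm K L c) ∣ classNumber K := by
      rw [classNumber]; exact orderOf_dvd_card
    exact Odd.of_dvd_nat hodd (h1.trans h2)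
  obtain ⟨y, hy⟩ := exists_sq_eq_of_odd_orderOf hPodd
  -- `P = c · σc` or `P = c` (if `σ = 1`)
  by_cases hσ1 : σ = 1
  · subst hσ1
    refine ⟨1, ?_⟩
    rw [mulEquiv_intAut_one, MulEquiv.refl_apply, div_self', map_one]
  · have hcard : Fintype.card (L ≃ₐ[K] L) = 2 := by rw [← Nat.card_eq_fintype_card, IsGalois.card_aut_eq_finrank, hdeg]
    have huniv : (Finset.univ : Finset (L ≃ₐ[K] L)) = {1, σ} := by
      symm
      apply Finset.eq_univ_of_card
      rw [Finset.card_pair (Ne.symm hσ1), hcard]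
    have hPmul : P = c * ClassGroup.mulEquiv (intAut σ) c := by
      rw [hP, huniv, Finset.prod_pair (Ne.symm hσ1), mulEquiv_intAut_one, MulEquiv.refl_apply]
    refine ⟨y * c⁻¹, ?_⟩
    rw [powMonoidHom_apply, mul_pow, hy, hPmul, div_eq_mul_inv, pow_two]
    calc c * ClassGroup.mulEquiv (intAut σ) c * (c⁻¹ * c⁻¹)
        = ClassGroup.mulEquiv (intAut σ) c * c⁻¹ * (c * c⁻¹) := by simp only [mul_assoc, mul_comm, mul_left_comm]
      _ = ClassGroup.mulEquiv (intAut σ) c * c⁻¹ := by rw [mul_inv_cancel, mul_one]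

/-- ★ **The `2`-rank genus bound with odd base class number.**  `L/K` Galois of degree `2` with `h_K` odd and `N_{L/K} : Cl(L) → Cl(K)` onto (e.g. some place
ramifies); then **`[Cl(L) : Cl(L)²] · 2 · [E_K : E_K ∩ N_{L/K} Lˣ] ≤ ∏_𝔭 e_𝔭 · ∏_{v∣∞} e_v`** — i.e. `rank₂ Cl(L) + 1 + r_E ≤ t + log₂ e_∞` with `2^{r_E} ∣ [E_K : E_K ∩ N Lˣ]`
(Chevalley's unit norm index inside `Lˣ`).  From `index_pow_sup_range_mul_le_genus` (`p = 2`): the coinvariant subgroup is `Cl(L)²` (`range_div_id_le_range_pow_two_of_odd`)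
and `[Cl(K) : Cl(K)²] = 1` (squaring is onto a group of odd order). [cite: Gras2003, IV.4] [cite: Lang1990, Ch. 13 §4, Lemma 4.1 (PDF p. 203)] -/
theorem index_pow_two_mul_le_genus_of_odd_classNumber [IsGalois K L] (hdeg : Module.finrank K L = 2) (hodd : Odd (classNumber K))
    (hN : Function.Surjective (classGroupNorm K L)) :
    (powMonoidHom 2 : ClassGroup (𝓞 L) →* ClassGroup (𝓞 L)).range.index * 2 *
        (unitsE L ⊓ (⊤ : Subgroup Lˣ).map (Herbrand.norm (L ≃ₐ[K] L))).relIndex (unitsE L ⊓ (unitsIncl K L).range) ≤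
      (∏ᶠ v : HeightOneSpectrum (𝓞 K), v.asIdeal.ramificationIdxIn (𝓞 L)) * ArchHerbrand.archFactor K L := by
  classical
  haveI : FiniteDimensional K L := Module.Finite.of_restrictScalars_finite ℚ K L
  have hcard : Nat.card (L ≃ₐ[K] L) = 2 := by rw [IsGalois.card_aut_eq_finrank, hdeg]
  haveI : Fact (Nat.Prime 2) := ⟨Nat.prime_two⟩
  haveI : IsCyclic (L ≃ₐ[K] L) := isCyclic_of_prime_card hcard
  obtain ⟨σ, hσ⟩ := IsCyclic.exists_generator (α := L ≃ₐ[K] L)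
  have h := index_pow_sup_range_mul_le_genus hσ hN 2
  -- the coinvariant subgroup is `Cl(L)²`
  have hsup : (powMonoidHom 2 : ClassGroup (𝓞 L) →* ClassGroup (𝓞 L)).range ⊔
      ((ClassGroup.mulEquiv (intAut σ)).toMonoidHom / MonoidHom.id (ClassGroup (𝓞 L))).range =
        (powMonoidHom 2 : ClassGroup (𝓞 L) →* ClassGroup (𝓞 L)).range :=
    sup_eq_left.mpr (range_div_id_le_range_pow_two_of_odd hdeg hodd σ)
  -- `[Cl(K) : Cl(K)²] = 1`
  have hK : (powMonoidHom 2 : ClassGroup (𝓞 K) →* ClassGroup (𝓞 K)).range.index = 1 := by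
    rw [Subgroup.index_eq_one, eq_top_iff]
    intro a _
    have hcop : (Nat.card (ClassGroup (𝓞 K))).Coprime 2 := by
      rw [Nat.card_eq_fintype_card, ← classNumber]
      exact Nat.Coprime.symm ((Nat.coprime_two_left).mpr hodd)
    refine ⟨(powCoprime hcop).symm a, ?_⟩
    rw [powMonoidHom_apply, ← powCoprime_apply hcop, Equiv.apply_symm_apply]
  rw [hsup, hdeg, hK, one_mul] at h
  exact h

/-- **Unramified at infinity**: `L/K` Galois quadratic, no real place of `K` complex in `L`, `h_K` odd, `N_{L/K}` onto, `t` ramified primes: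
**`[Cl(L) : Cl(L)²] · 2 · [E_K : E_K ∩ N Lˣ] ≤ 2^t`** (`rank₂ Cl(L) ≤ t − 1 − r_E`). [cite: Gras2003, IV.4] [cite: Lang1990, Ch. 13 §4, Lemma 4.1 and proof of Lemma 4.2] -/
theorem index_pow_two_mul_le_pow_of_odd_classNumber [IsGalois K L] [IsUnramifiedAtInfinitePlaces K L] (hdeg : Module.finrank K L = 2)
    (hodd : Odd (classNumber K)) (hN : Function.Surjective (classGroupNorm K L)) :
    (powMonoidHom 2 : ClassGroup (𝓞 L) →* ClassGroup (𝓞 L)).range.index * 2 *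
        (unitsE L ⊓ (⊤ : Subgroup Lˣ).map (Herbrand.norm (L ≃ₐ[K] L))).relIndex (unitsE L ⊓ (unitsIncl K L).range) ≤
      2 ^ {v : HeightOneSpectrum (𝓞 K) | v.asIdeal.ramificationIdxIn (𝓞 L) ≠ 1}.ncard := by
  have h := index_pow_two_mul_le_genus_of_odd_classNumber hdeg hodd hN
  rwa [archFactor_eq_one, mul_one, finprod_ramificationIdxIn_eq_pow_of_prime Nat.prime_two hdeg] at h

end Literature.NumberTheory.NumberFields.AmbiguousClass

end
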